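import Summits.BirchSwinnertonDyer.BirchSwinnertonDyer.Theorems.UniversalToricDescentRelaxedDualChainLemmas
import HarnessLib

/-!
# The dual-term bound of the relaxed count road: `#(KS_m(T) / KS_m(T ∪ V)) ≤ #(E(K_{∞,η})[p^∞]/Div)^{p^c}` for `m ≫ 0`
# (crux ♭T≤ stmt-BirchSwinnertonDyer-23042, line `sigmacongruence`, stub R1 `stub_relaxedImageCount`, brick (d) part 3)

Route `UniversalToricDescent`, lead prover `bsd-wall-utd-p1` g18. THEOREMS ONLY (no definition, no named fact, no `sorry`);
`--supports stmt-BirchSwinnertonDyer-23042`. BSD is not proved by any of this.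

`K` totally complex, `E = W/K` elliptic with `E(K_∞)[p^∞] = 0` along the `ℤ_p`-extension `κ` (topological generator `γ`), `T_K ∋ 𝔭′` a finite
set of finite places with `Sel^{S′}_{𝔭′}(K_∞, E[p^∞])[p^k]` FINITE, `v ∉ T_K` tame with `κ(D_v) = p^c ℤ_p`, `Div` the divisible part of
`E(K_{∞,η})[p^∞]`. For the layers `K_m` and the strict Kummer groups `KS_m(T) ⊇ KS_m(T ∪ V)` of `E_{K_m}[p^k]` (strict at the places over
`T_K`, resp. over `T_K ∪ {v}`, and at infinity; Kummer elsewhere):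

* §1 `exists_levelShift_transfer` — a class `y ∈ KS_L(T)` at level `Γ_n` whose `K_∞`-restriction is locally trivial at `v` after every
  `conj_{γ^i}`, `i < p^c`, transfers into `KS_{L'}(T ∪ V)` at every level `Γ_m`, `m ≥ n₁(y)` (level shifting `…RelaxedLocalLevelShift` +
  the double-coset reduction `σ = d γ^i h` of `…SigmaLocalSurjective`).
* §2 **`exists_level_dualIndex_le`** — **∃ `m₀`, ∀ `m ≥ m₀`: `#(KS_m(T)/KS_m(T ∪ V)) ≤ #(E(K_{∞,η})[p^∞]/Div)^{p^c}`**: the images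
  `J_m = Θ_m(KS_m(T)) ⊆ Sel^{S′}_{𝔭′}(K_∞)[p^k]` increase and stabilise (`J_m = J_N`, `m ≥ N`); `#(KS_N(T)/Y★) ≤ t^{p^c}`
  (`…DualChainLemmas.exists_starSubgroup`); `Y★` transfers into `KS_m(T ∪ V)` for `m ≥ m₀` (§1); the transports are injective; Lagrange.
  This is the input (d) of the relaxed count road: the Poitou–Tate dual index of the pair `kummerRelaxed(T∪∞) ≤ kummerRelaxed(T∪V∪∞)` over
  `K_m` (`…RelaxedKummerPairCountStrict`) is bounded UNIFORMLY in `k`.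

References: [GreenbergLNM1716] §2 Prop. 2.1, §3 Lemma 3.1 and its proof (pp. 85–87), §5 p. 114; [MilneADT2006] I.§6 (Prop. 6.9);
[Howard2004HeegnerKolyvagin] Def. 2.1.1, Thm. 2.1.11; [SerreGaloisCohomology1997] I.§2.5.
-/

set_option linter.dupNamespace false
set_option autoImplicit false

noncomputable section
open scoped Classical
open CategoryTheory Field NumberField IsDedekindDomain Function
open Literature.NumberTheory.EllipticCurves Literature.NumberTheory.EllipticCurves.GreenbergSelmer
open Literature.NumberTheory.GaloisRepresentations
open Literature.NumberTheory.GaloisRepresentations.DiscreteGaloisModule (SelmerStructure)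
open Literature.NumberTheory.GaloisCohomology
open scoped ContRepresentation
open scoped NumberField.LiesOver

namespace Summit.BirchSwinnertonDyer.BirchSwinnertonDyer.Theorems.UniversalToricDescentRelaxedDualChain

open Summit.BirchSwinnertonDyer.Rank1Residual.X11b.KummerPT Summit.BirchSwinnertonDyer.Rank1Residual.X11b.LocBridge
  Summit.BirchSwinnertonDyer.Rank1Residual.X11b.Coinv Summit.BirchSwinnertonDyer.Rank1Residual.X11b.AcSelmer
  Summit.BirchSwinnertonDyer.BirchSwinnertonDyer.Theorems.SignedEC.RelaxedKummerCount
  Summit.BirchSwinnertonDyer.Rank1Residual.Additive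
  Summit.BirchSwinnertonDyer.BirchSwinnertonDyer.Theorems.UniversalToricDescentRelaxedLayerTransportTorsion
  Summit.BirchSwinnertonDyer.BirchSwinnertonDyer.Theorems.UniversalToricDescentRelaxedDualTransfer
  Summit.BirchSwinnertonDyer.BirchSwinnertonDyer.Theorems.UniversalToricDescentRelaxedLayerSelmer
  Summit.BirchSwinnertonDyer.BirchSwinnertonDyer.Theorems.UniversalToricDescentRelaxedLocalLevelShift
  Summit.BirchSwinnertonDyer.BirchSwinnertonDyer.Theorems.UniversalToricDescentRelaxedDualChainLemmas
  Summit.BirchSwinnertonDyer.BirchSwinnertonDyer.Theorems.UniversalToricDescentSigmaLocalImage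
  Summit.BirchSwinnertonDyer.BirchSwinnertonDyer.Theorems.UniversalToricDescentLayerDegreeCertificate

variable {K : Type} [Field K] [NumberField K] (W : WeierstrassCurve K) [W.IsElliptic] (p k : ℕ) [Fact p.Prime]
  (κ : ZpExtension K p) (TK : Finset (HeightOneSpectrum (𝓞 K)))

/-! ## §1 Level shifting of the transfer into `KS(T ∪ V)` -/

section Shift

variable (n : ℕ) (L : Type) [Field L] [NumberField L] [Algebra K L]
  (ΦM : galoisCohomology ((W.baseChange L).torsionGaloisModule ((p ^ k : ℕ) : ℤ)) 1 →+
    subgroupH1 (κ.layerSubgroup n) (W.geomTorsion ((p ^ k : ℕ) : ℤ)))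
  (Φ : galoisCohomology ((W.baseChange L).torsionGaloisModule ((p ^ k : ℕ) : ℤ)) 1 →+ W.subgroupH1 p (κ.layerSubgroup n))
  (hΦ : ∀ z, Φ z = resH1Hom (ContinuousMonoidHom.id (κ.layerSubgroup n))
    (AddSubgroup.inclusion (Literature.Barriers.BirchSwinnertonDyer.geomTorsion_pow_le_geomPrimaryTorsion W p k)) (fun _ _ ↦ rfl) (ΦM z))
  (hdict : ∀ (u : HeightOneSpectrum (𝓞 K)) (z : galoisCohomology ((W.baseChange L).torsionGaloisModule ((p ^ k : ℕ) : ℤ)) 1),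
    (∀ w : HeightOneSpectrum (𝓞 L), w.asIdeal.LiesOver u.asIdeal →
      galoisCohomology.localization ((W.baseChange L).torsionGaloisModule ((p ^ k : ℕ) : ℤ)) (Sum.inr w) 1 z = 0) ↔
    ∀ σ : absoluteGaloisGroup K, conjH1 (κ.layerSubgroup n) (W.geomTorsion ((p ^ k : ℕ) : ℤ)) σ (ΦM z) ∈
      awayKer (κ.layerSubgroup n) (W.geomTorsion ((p ^ k : ℕ) : ℤ)) u)
  (hkum : ∀ (u : HeightOneSpectrum (𝓞 K)) (x : galoisCohomology ((W.baseChange L).torsionGaloisModule ((p ^ k : ℕ) : ℤ)) 1),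
    (∀ w : HeightOneSpectrum (𝓞 L), w.asIdeal.LiesOver u.asIdeal →
      galoisCohomology.res ((W.baseChange L).torsionGaloisModule ((p ^ k : ℕ) : ℤ)) (w.adicCompletion L) 1 x ∈
        (W.baseChange L).kummerLocalConditionAt ((p ^ k : ℕ) : ℤ) (w.adicCompletion L)) ↔
    ∀ σ : absoluteGaloisGroup K, W.conjH1 p (κ.layerSubgroup n) σ (Φ x) ∈ W.localKerOver p (κ.layerSubgroup n) (u.adicCompletion K))
  (TL : Finset (HeightOneSpectrum (𝓞 L))) (hTL : ∀ w, w ∈ TL ↔ w.under (𝓞 K) ∈ TK)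

omit [W.IsElliptic] in
include hΦ hdict hkum hTL in
/-- **Level shifting of the transfer.** For `y ∈ KS_L(T)` at level `Γ_n` with `conj_{γ^i} (res_{H ≤ Γ_n} Φ^M y)` locally trivial at `v`
over `K_∞` for all `i < p^c` (`κ(D_v) = p^c ℤ_p`): there is `n₁` such that for every `m ≥ n₁`, `m ≥ n`, and every level-`Γ_m` transport
over a totally complex `L'`, the transfer `y'` of `y` lies in `KS_{L'}(T ∪ V)` (strict also over `v`) and `Φ' y' = res (Φ y)`.
[cite: GreenbergLNM1716, §3 (proof of Lemma 3.1, pp. 85–87)] [cite: SerreGaloisCohomology1997, I.§2.5] -/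
theorem exists_levelShift_transfer (hcont : ∀ m : W.geomTorsion ((p ^ k : ℕ) : ℤ), Continuous fun g : absoluteGaloisGroup K ↦ g • m)
    {v : HeightOneSpectrum (𝓞 K)} {γ : absoluteGaloisGroup K} (hγ : κ.IsTopGenerator γ) {c : ℕ}
    (hc : ∀ z : ℤ_[p], ∃ d : decomp (K := K) v, (κ (d : absoluteGaloisGroup K)).toAdd = (p : ℤ_[p]) ^ c * z)
    {y : galoisCohomology ((W.baseChange L).torsionGaloisModule ((p ^ k : ℕ) : ℤ)) 1}
    (hy : y ∈ (kummerStrict (W.baseChange L) (p ^ k) (TL.image Sum.inr ∪ Finset.univ.image Sum.inl)).selmerGroup)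
    (hstar : ∀ i : ℕ, i < p ^ c →
      conjH1 κ.kerSubgroup (W.geomTorsion ((p ^ k : ℕ) : ℤ)) (γ ^ i)
          (resOfLe (W.geomTorsion ((p ^ k : ℕ) : ℤ)) (κ.kerSubgroup_le_layerSubgroup n) (ΦM y)) ∈
        awayKer κ.kerSubgroup (W.geomTorsion ((p ^ k : ℕ) : ℤ)) v) :
    ∃ n₁ : ℕ, ∀ m : ℕ, n₁ ≤ m → ∀ (hnm : n ≤ m)
      (L' : Type) [Field L'] [NumberField L'] [Algebra K L'], (∀ w : InfinitePlace L', w.IsComplex) →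
      ∀ (ΦM' : galoisCohomology ((W.baseChange L').torsionGaloisModule ((p ^ k : ℕ) : ℤ)) 1 →+
          subgroupH1 (κ.layerSubgroup m) (W.geomTorsion ((p ^ k : ℕ) : ℤ)))
        (Φ' : galoisCohomology ((W.baseChange L').torsionGaloisModule ((p ^ k : ℕ) : ℤ)) 1 →+ W.subgroupH1 p (κ.layerSubgroup m)),
        (∀ z, Φ' z = resH1Hom (ContinuousMonoidHom.id (κ.layerSubgroup m))
          (AddSubgroup.inclusion (Literature.Barriers.BirchSwinnertonDyer.geomTorsion_pow_le_geomPrimaryTorsion W p k))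
          (fun _ _ ↦ rfl) (ΦM' z)) →
        Function.Surjective ΦM' →
        (∀ (u : HeightOneSpectrum (𝓞 K)) (z : galoisCohomology ((W.baseChange L').torsionGaloisModule ((p ^ k : ℕ) : ℤ)) 1),
          (∀ w : HeightOneSpectrum (𝓞 L'), w.asIdeal.LiesOver u.asIdeal →
            galoisCohomology.localization ((W.baseChange L').torsionGaloisModule ((p ^ k : ℕ) : ℤ)) (Sum.inr w) 1 z = 0) ↔
          ∀ σ : absoluteGaloisGroup K, conjH1 (κ.layerSubgroup m) (W.geomTorsion ((p ^ k : ℕ) : ℤ)) σ (ΦM' z) ∈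
            awayKer (κ.layerSubgroup m) (W.geomTorsion ((p ^ k : ℕ) : ℤ)) u) →
        (∀ (u : HeightOneSpectrum (𝓞 K)) (x : galoisCohomology ((W.baseChange L').torsionGaloisModule ((p ^ k : ℕ) : ℤ)) 1),
          (∀ w : HeightOneSpectrum (𝓞 L'), w.asIdeal.LiesOver u.asIdeal →
            galoisCohomology.res ((W.baseChange L').torsionGaloisModule ((p ^ k : ℕ) : ℤ)) (w.adicCompletion L') 1 x ∈
              (W.baseChange L').kummerLocalConditionAt ((p ^ k : ℕ) : ℤ) (w.adicCompletion L')) ↔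
          ∀ σ : absoluteGaloisGroup K,
            W.conjH1 p (κ.layerSubgroup m) σ (Φ' x) ∈ W.localKerOver p (κ.layerSubgroup m) (u.adicCompletion K)) →
      ∀ (TL' : Finset (HeightOneSpectrum (𝓞 L'))), (∀ w, w ∈ TL' ↔ w.under (𝓞 K) ∈ TK) →
      ∀ (VL' : Finset (HeightOneSpectrum (𝓞 L'))), (∀ w, w ∈ VL' ↔ w.under (𝓞 K) = v) →
      ∃ y' : galoisCohomology ((W.baseChange L').torsionGaloisModule ((p ^ k : ℕ) : ℤ)) 1,
        y' ∈ (kummerStrict (W.baseChange L') (p ^ k)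
          ((TL'.image Sum.inr ∪ Finset.univ.image Sum.inl) ∪ VL'.image Sum.inr)).selmerGroup ∧
        Φ' y' = W.resOfLe p (κ.layerSubgroup_antitone hnm) (Φ y) := by
  classical
  set M := W.geomTorsion ((p ^ k : ℕ) : ℤ) with hM
  -- the classes `x_i = res_{Γ_n ∩ D_v} (conj_{γ^i} Φ^M y)` die on `ker κ ∩ D_v`
  have hx : ∀ i : ℕ, i < p ^ c →
      resOfLe M (inf_le_inf_right (decomp v) (κ.kerSubgroup_le_layerSubgroup n))
        (resOfLe M (inf_le_left : κ.layerSubgroup n ⊓ decomp v ≤ κ.layerSubgroup n)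
          (conjH1 (κ.layerSubgroup n) M (γ ^ i) (ΦM y))) = 0 := by
    intro i hi
    have h := hstar i hi
    rw [awayKer, AddMonoidHom.mem_ker] at h
    have e := congrArg (fun f ↦ f (ΦM y)) (resOfLe_comp_conjH1_holds (M := M) (κ.kerSubgroup_le_layerSubgroup n) (γ ^ i))
    simp only [AddMonoidHom.coe_comp, Function.comp_apply] at e
    rw [← e, ← AddMonoidHom.comp_apply, resOfLe_comp_holds (M := M)] at h
    rw [← AddMonoidHom.comp_apply, resOfLe_comp_holds (M := M)]
    exact h
  have hshift : ∀ i : ℕ, i < p ^ c → ∃ n₁ : ℕ, ∀ m : ℕ, n₁ ≤ m →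
      ∀ h : κ.layerSubgroup m ⊓ decomp v ≤ κ.layerSubgroup n ⊓ decomp v,
        resOfLe M h (resOfLe M (inf_le_left : κ.layerSubgroup n ⊓ decomp v ≤ κ.layerSubgroup n)
          (conjH1 (κ.layerSubgroup n) M (γ ^ i) (ΦM y))) = 0 :=
    fun i hi ↦ exists_resOfLe_layer_inf_decomp_eq_zero κ hcont v n _ (hx i hi)
  choose! n₁ hn₁ using hshift
  refine ⟨(Finset.range (p ^ c)).sup n₁, fun m hm hnm L' _ _ _ hL' ΦM' Φ' hΦ' hsurj' hdict' hkum' TL' hTL' VL' hVL' ↦ ?_⟩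
  obtain ⟨y', hy', hM', hΦy'⟩ := exists_transfer W p k TK L (κ.layerSubgroup n) ΦM Φ hΦ hdict hkum TL hTL L' (κ.layerSubgroup m)
    (κ.layerSubgroup_antitone hnm) ΦM' Φ' hΦ' hsurj' hdict' hkum' TL' hTL' hL' hy
  refine ⟨y', ?_, hΦy'⟩
  rw [mem_kummerStrict_union_iff W p k TK L' (κ.layerSubgroup m) ΦM' hdict' TL' hTL' VL' hVL']
  refine ⟨hy', fun σ ↦ ?_⟩
  -- `σ = d γ^i h`, `d ∈ D_v`, `i < p^c`, `h ∈ ker κ`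
  obtain ⟨d, i, h, hi, hh, rfl⟩ := exists_decomp_mul_pow_lt_mul_mem_ker κ hγ v hc σ
  rw [conjH1_mul_holds (κ.layerSubgroup m) M, conjH1_mul_holds (κ.layerSubgroup m) M, AddMonoidHom.comp_apply, AddMonoidHom.comp_apply,
    conjH1_of_mem_holds (κ.layerSubgroup m) M (κ.kerSubgroup_le_layerSubgroup m hh), AddMonoidHom.id_apply, awayKer, AddMonoidHom.mem_ker,
    ← resOfLe_inf_eq_zero_iff_conjH1 (κ.layerSubgroup m) (decomp v) (decomp v) (d : absoluteGaloisGroup K)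
      (fun g ↦ ⟨fun hg ↦ mul_mem (mul_mem d.2 hg) (inv_mem d.2), fun hg ↦ by
        have e : g = (d : absoluteGaloisGroup K)⁻¹ * ((d : absoluteGaloisGroup K) * g * (d : absoluteGaloisGroup K)⁻¹) * d := by group
        rw [e]
        exact mul_mem (mul_mem (inv_mem d.2) hg) d.2⟩),
    hM']
  -- `res_{Γ_m ∩ D_v} (conj_{γ^i} (res Φ^M y)) = res_h (x_i) = 0`
  have e := congrArg (fun f ↦ f (ΦM y)) (resOfLe_comp_conjH1_holds (M := M) (κ.layerSubgroup_antitone hnm) (γ ^ i))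
  simp only [AddMonoidHom.coe_comp, Function.comp_apply] at e
  have hle : κ.layerSubgroup m ⊓ decomp v ≤ κ.layerSubgroup n ⊓ decomp v := inf_le_inf_right _ (κ.layerSubgroup_antitone hnm)
  rw [← e, ← AddMonoidHom.comp_apply, resOfLe_comp_holds (M := M), ← resOfLe_comp_holds (M := M) hle inf_le_left, AddMonoidHom.comp_apply]
  exact hn₁ i hi m (le_trans (Finset.le_sup (Finset.mem_range.mpr hi)) hm) hle

end Shift

/-! ## §2 The dual-term bound -/

section Bound

-- nine transported data per layer (`choose`) and several finite-cardinality transfers: the default budget is marginally too small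
set_option maxHeartbeats 400000 in
/-- **∃ `m₀`, ∀ `m ≥ m₀`: `#(KS_m(T)/KS_m(T ∪ V)) ≤ #(E(K_{∞,η})[p^∞]/Div)^{p^c}`** (module docstring, §2). The place sets `T_m ⊆` places of
`K_m` over `T_K` and `V_m` = places over `v` are parameters with their specifications. [cite: GreenbergLNM1716, §3 Lemma 3.1 (pp. 85–87)]
[cite: MilneADT2006, Ch. I §6 (Prop. 6.9)] [cite: Howard2004HeegnerKolyvagin, Thm. 2.1.11] -/
theorem exists_level_dualIndex_le [IsTotallyComplex K]
    (hB : FixedPoints.addSubgroup κ.kerSubgroup (W.geomPrimaryTorsion p) = ⊥)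
    {γ : absoluteGaloisGroup K} (hγ : κ.IsTopGenerator γ)
    {𝔭' : HeightOneSpectrum (𝓞 K)} (h𝔭' : 𝔭' ∈ TK) (S' : Set (HeightOneSpectrum (𝓞 K)))
    (hfin : Set.Finite {s : W.subgroupH1 p κ.kerSubgroup | s ∈ selmerAc W p κ 𝔭' S' ∧ p ^ k • s = 0})
    {v : HeightOneSpectrum (𝓞 K)} (hpv : ((p : ℕ) : 𝓞 K) ∉ v.asIdeal) (hvT : v ∉ TK) {c : ℕ}
    (hc : ∀ z : ℤ_[p], ∃ d : decomp (K := K) v, (κ (d : absoluteGaloisGroup K)).toAdd = (p : ℤ_[p]) ^ c * z)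
    {D : AddSubgroup (FixedPoints.addSubgroup (kerD κ v) (W.geomPrimaryTorsion p))}
    (hDmem : ∀ b, b ∈ D ↔ ∀ j : ℕ, ∃ b', p ^ j • b' = b) (hDdiv : ∀ d ∈ D, ∃ d' ∈ D, p • d' = d)
    [Finite (FixedPoints.addSubgroup (kerD κ v) (W.geomPrimaryTorsion p) ⧸ D)]
    (TL : ∀ n : ℕ, Finset (HeightOneSpectrum (𝓞 (κ.layer n)))) (hTL : ∀ n w, w ∈ TL n ↔ w.under (𝓞 K) ∈ TK)
    (VL : ∀ n : ℕ, Finset (HeightOneSpectrum (𝓞 (κ.layer n)))) (hVL : ∀ n w, w ∈ VL n ↔ w.under (𝓞 K) = v) :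
    ∃ m₀ : ℕ, ∀ m : ℕ, m₀ ≤ m →
      Nat.card ((kummerStrict (W.baseChange (κ.layer m)) (p ^ k) ((TL m).image Sum.inr ∪ Finset.univ.image Sum.inl)).selmerGroup ⧸
        ((kummerStrict (W.baseChange (κ.layer m)) (p ^ k)
          (((TL m).image Sum.inr ∪ Finset.univ.image Sum.inl) ∪ (VL m).image Sum.inr)).selmerGroup).addSubgroupOf
          (kummerStrict (W.baseChange (κ.layer m)) (p ^ k) ((TL m).image Sum.inr ∪ Finset.univ.image Sum.inl)).selmerGroup) ≤
      Nat.card (FixedPoints.addSubgroup (kerD κ v) (W.geomPrimaryTorsion p) ⧸ D) ^ (p ^ c) := by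
  classical
  set M := W.geomTorsion ((p ^ k : ℕ) : ℤ) with hM
  set t := Nat.card (FixedPoints.addSubgroup (kerD κ v) (W.geomPrimaryTorsion p) ⧸ D) with ht
  have hcx : ∀ (n : ℕ) (w : InfinitePlace (κ.layer n)), w.IsComplex := fun n w ↦ by
    haveI := isTotallyComplex_of_algebra K (κ.layer n)
    exact IsTotallyComplex.isComplex w
  have hcont : ∀ m : M, Continuous fun g : absoluteGaloisGroup K ↦ g • m := fun m ↦
    continuous_induced_rng.2 (by
      change Continuous fun g : absoluteGaloisGroup K ↦ ((g • m : M) : W.geomPoints)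
      exact continuous_smul_of_isOpen_stabilizer (m : W.geomPoints) (W.isOpen_stabilizer_point_holds _))
  -- transports at every layer
  have hpk := fun n : ℕ ↦ exists_transportTorsion_primary W p k (κ.layer n) (layerSubgroup_le_galRange_layer p κ n)
    (mem_comapResGal_layer p κ n)
  choose ΦM Φ hbij hΦ hdict hshadow htors hinj hkum using hpk
  -- the strict Kummer groups and `Θ_n = h_n ∘ Φ_n`
  let KS : ∀ n : ℕ, AddSubgroup (galoisCohomology ((W.baseChange (κ.layer n)).torsionGaloisModule ((p ^ k : ℕ) : ℤ)) 1) := fun n ↦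
    (kummerStrict (W.baseChange (κ.layer n)) (p ^ k) ((TL n).image Sum.inr ∪ Finset.univ.image Sum.inl)).selmerGroup
  let KSV : ∀ n : ℕ, AddSubgroup (galoisCohomology ((W.baseChange (κ.layer n)).torsionGaloisModule ((p ^ k : ℕ) : ℤ)) 1) := fun n ↦
    (kummerStrict (W.baseChange (κ.layer n)) (p ^ k)
      (((TL n).image Sum.inr ∪ Finset.univ.image Sum.inl) ∪ (VL n).image Sum.inr)).selmerGroup
  let Θ : ∀ n : ℕ, galoisCohomology ((W.baseChange (κ.layer n)).torsionGaloisModule ((p ^ k : ℕ) : ℤ)) 1 →+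
      W.subgroupH1 p κ.kerSubgroup := fun n ↦ (W.layerToInfty κ n).comp (Φ n)
  have hΘ : ∀ n y, Θ n y = W.layerToInfty κ n (Φ n y) := fun _ _ ↦ rfl
  have hΘinj : ∀ n, Function.Injective (Θ n) := fun n ↦
    (layerToInfty_injective_of_fixedPoints_eq_bot W p κ hγ hB n).comp (hinj n (baseChange_layer_fixed_eq_zero W p κ hB n))
  have hKSV_le : ∀ n, KSV n ≤ KS n := fun n z hz ↦
    ((mem_kummerStrict_union_iff W p k TK (κ.layer n) (κ.layerSubgroup n) (ΦM n) (hdict n) (TL n) (hTL n)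
      (VL n) (hVL n) z).mp hz).1
  -- the images `J_n ⊆ F`
  let F : Set (W.subgroupH1 p κ.kerSubgroup) := {s | s ∈ selmerAc W p κ 𝔭' S' ∧ p ^ k • s = 0}
  let J : ℕ → Set (W.subgroupH1 p κ.kerSubgroup) := fun n ↦ Θ n '' (KS n : Set _)
  have hJF : ∀ n, J n ⊆ F := by
    rintro n _ ⟨y, hy, rfl⟩
    exact layerToInfty_transport_mem W p k κ n TK (κ.layer n) (ΦM n) (Φ n) (hdict n) (hshadow n) (htors n) (hkum n) (TL n) (hTL n)
      h𝔭' S' hy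
  have hJmono : ∀ n m, n ≤ m → J n ⊆ J m := fun n m hnm ↦
    image_subset_image_of_le W p k κ TK hnm (κ.layer n) (ΦM n) (Φ n) (hΦ n) (hdict n) (hkum n) (TL n) (hTL n) (κ.layer m) (hcx m)
      (ΦM m) (Φ m) (hΦ m) (hbij m).2 (hdict m) (hkum m) (TL m) (hTL m)
  obtain ⟨N, hN⟩ := exists_stable_index J F hfin hJF hJmono
  -- finiteness
  haveI hFfin : Finite F := hfin.to_subtype
  have hKSfin : ∀ n, Finite (KS n) := fun n ↦ by
    refine Finite.of_injective (fun y : KS n ↦ (⟨Θ n y, hJF n ⟨y, y.2, rfl⟩⟩ : F)) fun a b h ↦ ?_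
    exact Subtype.ext (hΘinj n (congrArg Subtype.val h))
  -- `Y★` at level `N`
  obtain ⟨Ystar, hYmem, hYcard⟩ := exists_starSubgroup W p k κ N TK (κ.layer N) (ΦM N) (Φ N) (hΦ N) (hdict N) (hkum N) (TL N) (hTL N)
    hpv hvT γ c hDmem hDdiv
  -- level shifting for the elements of `Y★`
  have hL3 : ∀ y : KS N, y ∈ Ystar → ∃ n₁ : ℕ, ∀ m : ℕ, n₁ ≤ m → N ≤ m →
      ∃ y' ∈ KSV m, Θ m y' = Θ N y := by
    intro y hy
    obtain ⟨n₁, hn₁⟩ := exists_levelShift_transfer W p k κ TK N (κ.layer N) (ΦM N) (Φ N) (hΦ N) (hdict N) (hkum N) (TL N) (hTL N)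
      hcont hγ hc y.2 ((hYmem y).mp hy)
    refine ⟨n₁, fun m hm hNm ↦ ?_⟩
    obtain ⟨y', hy', hΦy'⟩ := hn₁ m hm hNm (κ.layer m) (hcx m) (ΦM m) (Φ m) (hΦ m) (hbij m).2 (hdict m) (hkum m) (TL m) (hTL m)
      (VL m) (hVL m)
    refine ⟨y', hy', ?_⟩
    rw [hΘ, hΘ, hΦy']
    have h := congrArg (fun f ↦ f (Φ N y)) (W.resOfLe_comp_holds p (κ.kerSubgroup_le_layerSubgroup m) (κ.layerSubgroup_antitone hNm))
    simp only [AddMonoidHom.coe_comp, Function.comp_apply] at h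
    exact h
  choose! n₁ hn₁ using hL3
  haveI := hKSfin N
  haveI : Fintype (KS N) := Fintype.ofFinite _
  refine ⟨max N (Finset.univ.sup n₁), fun m hm ↦ ?_⟩
  have hNm : N ≤ m := le_of_max_le_left hm
  have hn₂m : Finset.univ.sup n₁ ≤ m := le_of_max_le_right hm
  haveI := hKSfin m
  -- (i) `#KS_m = #KS_N`
  have e1 : Nat.card (KS m) = Nat.card (KS N) := by
    have a := Nat.card_image_of_injective (hΘinj m) (KS m : Set _)
    have b := Nat.card_image_of_injective (hΘinj N) (KS N : Set _)
    rw [SetLike.coe_sort_coe] at a b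
    rw [← a, ← b]
    change Nat.card (J m) = Nat.card (J N)
    rw [hN m hNm]
  -- (ii) `#Y★ ≤ #KSV_m`
  have e2 : Nat.card Ystar ≤ Nat.card (KSV m) := by
    have hsub : (fun y : KS N ↦ Θ N y) '' (Ystar : Set (KS N)) ⊆ Θ m '' (KSV m : Set _) := by
      rintro _ ⟨y, hy, rfl⟩
      obtain ⟨y', hy', he⟩ := hn₁ y hy m (le_trans (Finset.le_sup (Finset.mem_univ y)) hn₂m) hNm
      exact ⟨y', hy', he⟩
    have hKSVfin : (KSV m : Set _).Finite :=
      (Set.finite_coe_iff.mp (hKSfin m)).subset fun z hz ↦ hKSV_le m hz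
    have hfin' : (Θ m '' (KSV m : Set _)).Finite := hKSVfin.image _
    calc Nat.card Ystar = Nat.card ((fun y : KS N ↦ Θ N y) '' (Ystar : Set (KS N))) :=
          (Nat.card_image_of_injective ((hΘinj N).comp Subtype.val_injective) _).symm
      _ ≤ Nat.card (Θ m '' (KSV m : Set _)) := Nat.card_mono hfin' hsub
      _ = Nat.card (KSV m) := Nat.card_image_of_injective (hΘinj m) _
  -- (iii) Lagrange at both levels
  have e3 : Nat.card (KS N) = Nat.card (KS N ⧸ Ystar) * Nat.card Ystar := AddSubgroup.card_eq_card_quotient_mul_card_addSubgroup Ystar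
  have e4 : Nat.card (KS m) = Nat.card (KS m ⧸ (KSV m).addSubgroupOf (KS m)) * Nat.card ((KSV m).addSubgroupOf (KS m)) :=
    AddSubgroup.card_eq_card_quotient_mul_card_addSubgroup _
  have e5 : Nat.card ((KSV m).addSubgroupOf (KS m)) = Nat.card (KSV m) :=
    Nat.card_congr (AddSubgroup.addSubgroupOfEquivOfLe (hKSV_le m)).toEquiv
  haveI : Finite (KSV m) := Finite.of_injective (fun z : KSV m ↦ (⟨z, hKSV_le m z.2⟩ : KS m)) fun a b h ↦
    Subtype.ext (congrArg Subtype.val h :)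
  have hpos : 0 < Nat.card (KSV m) := Nat.card_pos
  refine Nat.le_of_mul_le_mul_right ?_ hpos
  calc Nat.card (KS m ⧸ (KSV m).addSubgroupOf (KS m)) * Nat.card (KSV m) = Nat.card (KS m) := by rw [e4, e5]
    _ = Nat.card (KS N ⧸ Ystar) * Nat.card Ystar := by rw [e1, e3]
    _ ≤ t ^ (p ^ c) * Nat.card (KSV m) := Nat.mul_le_mul hYcard e2

end Bound

end Summit.BirchSwinnertonDyer.BirchSwinnertonDyer.Theorems.UniversalToricDescentRelaxedDualChain

end
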